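/-
# Solo-blind programme on Kontsevich–Zagier, s6 part T3b: Euler's reflection at an algebraic cut

Continuing `SoloBlindDilogCut`: the rectangle `P(x) = (x,1) × (0,x)` of the cut simplex carries
the dilogarithm form `dt/(t₀(1−t₁))`; the affine chart `(t₀/x, (1−t₁)/(1−x))` — linear with
*algebraic* coefficients, hence `ℚ`-semialgebraic — maps it onto the box
`(1,1/x) × (1,1/(1−x))` with the form
`dv/(v₀v₁)` (one move of rule (2)); such a *logarithmic box* `[(1,a) × (1,b), dv/(v₀v₁)]` is, up
to a null set, the Fubini product of the logarithm cells `ℓ(a)`, `ℓ(b)`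
(`mkQ_logBox : [log-box] = ℓ(a)ℓ(b)`, reused by the Landen move).  With the dissection and the
reflection this gives **Euler's reflection formula as an identity of KZ classes**, uniformly in
the algebraic cut point `x ∈ (0,1)` (`mkQ_simplexTwo_cut`):

  `[Λ₂] = [D(x)] + [D(1−x)] + ℓ(1/x)·ℓ(1/(1−x))`  in `Q = FormalRep/relations`,

and, reading off periods, `Li₂(x) + Li₂(1−x) = π²/6 − log(1/x)·log(1/(1−x))`
(`dilogCut_value_add_symm`).
-/
import Summits.KontsevichZagierPeriods.KontsevichZagierPeriods.Theorems.SoloBlindDilogCut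

noncomputable section

open MeasureTheory Set MvPolynomial
open Literature.NumberTheory.Transcendental
open Literature.NumberTheory.Transcendental.KZ
open Literature.NumberTheory.Transcendental.KZ.IntegralRep
open Literature.ModelTheory.ExponentialFields (IsSemialgebraic isSemialgebraic_setOf_eval_pos)

namespace Summit.KontsevichZagierPeriods.KontsevichZagierPeriods.Theorems

namespace SoloBlind

variable (c : Cut)

/-! ## Move (2): the rectangle is the box `(1,1/x) × (1,1/(1−x))` with the form `du/(u₀u₁)` -/

/-! ## The logarithmic box `[(1,a) × (1,b), dv/(v₀v₁)] = ℓ(a)·ℓ(b)` -/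

section logBox

variable {a b : ℝ} (ha : IsAlgebraic ℚ a) (hb : IsAlgebraic ℚ b)

/-- The open box `(1,a) × (1,b)`. -/
def logBoxDom (a b : ℝ) : Set (Fin 2 → ℝ) := {v | 1 < v 0 ∧ v 0 < a ∧ 1 < v 1 ∧ v 1 < b}

/-- The logarithmic square form `1/(v₀v₁)`. -/
def logSqFun (v : Fin 2 → ℝ) : ℝ := 1 / (v 0 * v 1)

include ha hb in
/-- The box is semialgebraic (algebraic endpoints). -/
theorem isSemialgebraic_logBoxDom : IsSemialgebraic ℚ (logBoxDom a b) := by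
  have h : {v : Fin 2 → ℝ | 1 < v 0 ∧ 1 < v 1} =
      {v | 0 < aeval v (X 0 - 1 : MvPolynomial (Fin 2) ℚ)} ∩
        {v | 0 < aeval v (X 1 - 1 : MvPolynomial (Fin 2) ℚ)} := by
    ext v; simp [sub_pos]
  have h1 : IsSemialgebraic ℚ {v : Fin 2 → ℝ | 1 < v 0 ∧ 1 < v 1} := by
    rw [h]; exact (isSemialgebraic_setOf_eval_pos _).inter (isSemialgebraic_setOf_eval_pos _)
  have h2 := isSemialgebraic_sep_apply_lt h1 0 ha
  convert isSemialgebraic_sep_apply_lt h2 1 hb using 1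
  ext v; simp only [logBoxDom, mem_setOf_eq]; tauto

/-- `1/(v₀v₁)` is integrable on the box (continuous on the closed box). -/
theorem integrableOn_logSqFun : IntegrableOn logSqFun (logBoxDom a b) := by
  have hK : IntegrableOn logSqFun (Icc ![1, 1] ![a, b]) := by
    refine ContinuousOn.integrableOn_compact isCompact_Icc ?_
    refine continuousOn_const.div (by fun_prop) fun v hv => ?_
    have h0 : (1 : ℝ) ≤ v 0 := by simpa using hv.1 0
    have h1 : (1 : ℝ) ≤ v 1 := by simpa using hv.1 1
    exact mul_ne_zero (by linarith) (by linarith)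
  refine hK.mono_set fun v hv => ⟨fun i => ?_, fun i => ?_⟩
  · fin_cases i
    · simpa using hv.1.le
    · simpa using hv.2.2.1.le
  · fin_cases i
    · simpa using hv.2.1.le
    · simpa using hv.2.2.2.le

/-- **The logarithmic box** `[(1,a) × (1,b), dv/(v₀v₁)]`. -/
def logBox : IntegralRep 2 :=
  ratRep (logBoxDom a b) logSqFun 1 (X 0 * X 1) (isSemialgebraic_logBoxDom ha hb)
    (fun v hv => by
      simp only [logBoxDom, mem_setOf_eq] at hv
      simpa using mul_ne_zero (by linarith : v 0 ≠ 0) (by linarith : v 1 ≠ 0))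
    (fun v _ => by simp [logSqFun]) integrableOn_logSqFun

/-- **Product move (up to a null set).** The logarithmic box is the Fubini product of the
logarithm cells `ℓ(a) = [(1,a), dv/v]` and `ℓ(b)` (the closed product box differs from the open
one by a null set). -/
theorem logBox_sub_prod : of (logBox ha hb) -
    of ((logCell 1 a isAlgebraic_one ha).prod (logCell 1 b isAlgebraic_one hb)) ∈ relations := by
  have hdom : ((logCell 1 a isAlgebraic_one ha).prod (logCell 1 b isAlgebraic_one hb)).domain =
      {v : Fin 2 → ℝ | v 0 ∈ Icc 1 a ∧ v 1 ∈ Icc 1 b} := by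
    ext v
    simp only [IntegralRep.prod_domain, IntegralRep.mem_prodDomain, logCell_eq, logSeg_domain,
      line, mem_setOf_eq]
    exact Iff.rfl
  refine of_sub_of_mem_relations_of_null _ _ ?_ ?_ ?_
  · exact measure_mono_null (fun v ⟨hs, hn⟩ => absurd (hdom ▸
      ⟨⟨hs.1.le, hs.2.1.le⟩, ⟨hs.2.2.1.le, hs.2.2.2.le⟩⟩) hn) measure_empty
  · rw [hdom]
    have hc : ∀ (i : Fin 2) (e : ℝ), volume {t : Fin 2 → ℝ | t i = e} = 0 := fun i e => by
      rw [volume_pi]; exact Measure.pi_hyperplane (fun _ : Fin 2 => (volume : Measure ℝ)) i e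
    refine measure_mono_null (fun v ⟨⟨h0, h1⟩, hn⟩ => ?_)
      (measure_union_null (measure_union_null (hc 0 1) (hc 0 a))
        (measure_union_null (hc 1 1) (hc 1 b)))
    have hn' : ¬(1 < v 0 ∧ v 0 < a ∧ 1 < v 1 ∧ v 1 < b) := hn
    by_contra hne
    simp only [mem_union, mem_setOf_eq, not_or] at hne
    obtain ⟨⟨h2, h3⟩, h4, h5⟩ := hne
    exact hn' ⟨lt_of_le_of_ne h0.1 (Ne.symm h2), lt_of_le_of_ne h0.2 h3,
      lt_of_le_of_ne h1.1 (Ne.symm h4), lt_of_le_of_ne h1.2 h5⟩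
  · intro v _
    show logSqFun v = ((logCell 1 a isAlgebraic_one ha).prod
      (logCell 1 b isAlgebraic_one hb)).integrand v
    rw [IntegralRep.prod_integrand_eq, IntegralRep.prodFun_apply]
    simp only [logSqFun, logCell_eq, logSeg_integrand]
    rw [one_div_mul_one_div]
    rfl

/-- **`[log-box] = ℓ(a)·ℓ(b)`** in `Q`. -/
theorem mkQ_logBox : mkQ (of (logBox ha hb)) = ell a * ell b := by
  rw [ell_eq ha, ell_eq hb, ← mkQ_mul, of_mul_of, mkQ_eq_mkQ_iff]
  exact logBox_sub_prod ha hb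

end logBox

/-! ## Move (2): the rectangle is the logarithmic box of `1/x`, `1/(1−x)` -/

/-- The affine chart `(t₀, t₁) ↦ (t₀/x, (1−t₁)/(1−x))`. -/
def cutChart (t : Fin 2 → ℝ) : Fin 2 → ℝ := ![c.x⁻¹ * t 0, (1 - c.x)⁻¹ * (1 - t 1)]

/-- Its (constant) derivative `diag(1/x, −1/(1−x))`. -/
def cutChartDeriv : (Fin 2 → ℝ) →L[ℝ] (Fin 2 → ℝ) :=
  ContinuousLinearMap.pi ![c.x⁻¹ • pr2 0, -((1 - c.x)⁻¹ • pr2 1)]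

/-- The chart has the stated derivative. -/
theorem hasFDerivAt_cutChart (t : Fin 2 → ℝ) : HasFDerivAt (cutChart c) (cutChartDeriv c) t := by
  rw [hasFDerivAt_pi']
  intro i
  have hrow : (pr2 i).comp (cutChartDeriv c) = ![c.x⁻¹ • pr2 0, -((1 - c.x)⁻¹ • pr2 1)] i :=
    ContinuousLinearMap.ext fun v => by simp [cutChartDeriv]
  rw [hrow]
  fin_cases i
  · simpa [cutChart] using (hasFDerivAt_apply (0 : Fin 2) t).const_mul c.x⁻¹
  · simpa [cutChart, mul_sub] using
      ((hasFDerivAt_apply (1 : Fin 2) t).const_mul (1 - c.x)⁻¹).const_sub (1 - c.x)⁻¹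

/-- The matrix of the derivative. -/
theorem toMatrix_cutChartDeriv :
    LinearMap.toMatrix' ((cutChartDeriv c : (Fin 2 → ℝ) →L[ℝ] (Fin 2 → ℝ)) :
      (Fin 2 → ℝ) →ₗ[ℝ] (Fin 2 → ℝ)) = !![c.x⁻¹, 0; 0, -(1 - c.x)⁻¹] := by
  ext i j
  rw [LinearMap.toMatrix'_apply, ContinuousLinearMap.coe_coe]
  fin_cases i <;> fin_cases j <;> simp [cutChartDeriv]

/-- `|det| = 1/(x(1−x))`. -/
theorem abs_det_cutChartDeriv : |(cutChartDeriv c).det| = c.x⁻¹ * (1 - c.x)⁻¹ := by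
  rw [ContinuousLinearMap.det, ← LinearMap.det_toMatrix', toMatrix_cutChartDeriv,
    Matrix.det_fin_two_of]
  simp only [mul_neg, mul_zero, sub_zero, abs_neg]
  exact abs_of_pos (mul_pos (inv_pos.2 c.pos) (inv_pos.2 c.symm_pos))

/-- The chart is injective. -/
theorem injective_cutChart : Function.Injective (cutChart c) := by
  intro s t h
  have hx : c.x⁻¹ ≠ 0 := inv_ne_zero c.pos.ne'
  have hy : (1 - c.x)⁻¹ ≠ 0 := inv_ne_zero c.symm_pos.ne'
  have h0 := congr_fun h 0
  have h1 := congr_fun h 1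
  simp only [cutChart, Matrix.cons_val_zero, Matrix.cons_val_one] at h0 h1
  have e0 := mul_left_cancel₀ hx h0
  have e1 := mul_left_cancel₀ hy h1
  funext i
  fin_cases i
  · exact e0
  · show s 1 = t 1
    linarith

/-- The chart maps `P(x)` onto the box. -/
theorem image_cutChart : cutChart c '' cutRect c = logBoxDom c.x⁻¹ (1 - c.x)⁻¹ := by
  have hx := c.pos
  have hy := c.symm_pos
  have ix : c.x⁻¹ * c.x = 1 := inv_mul_cancel₀ hx.ne'
  have iy : (1 - c.x)⁻¹ * (1 - c.x) = 1 := inv_mul_cancel₀ hy.ne'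
  ext u
  simp only [mem_image, cutRect, logBoxDom, mem_setOf_eq]
  constructor
  · rintro ⟨t, ⟨h1, h2, h3, h4⟩, rfl⟩
    simp only [cutChart, Matrix.cons_val_zero, Matrix.cons_val_one]
    have a1 := mul_lt_mul_of_pos_left h3 (inv_pos.2 hx)
    have a2 := mul_lt_mul_of_pos_left h4 (inv_pos.2 hx)
    have a3 := mul_lt_mul_of_pos_left (by linarith : 1 - c.x < 1 - t 1) (inv_pos.2 hy)
    have a4 := mul_lt_mul_of_pos_left (by linarith : 1 - t 1 < 1) (inv_pos.2 hy)
    rw [mul_one] at a2 a4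
    exact ⟨by linarith, a2, by linarith, a4⟩
  · rintro ⟨h1, h2, h3, h4⟩
    have b1 := mul_lt_mul_of_pos_left h1 hx
    have b2 := mul_lt_mul_of_pos_left h2 hx
    have b3 := mul_lt_mul_of_pos_left h3 hy
    have b4 := mul_lt_mul_of_pos_left h4 hy
    rw [mul_inv_cancel₀ hx.ne'] at b2
    rw [mul_inv_cancel₀ hy.ne'] at b4
    rw [mul_one] at b1 b3
    refine ⟨![c.x * u 0, 1 - (1 - c.x) * u 1], ⟨?_, ?_, ?_, ?_⟩, ?_⟩
    · show 0 < 1 - (1 - c.x) * u 1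
      linarith
    · show 1 - (1 - c.x) * u 1 < c.x
      linarith
    · show c.x < c.x * u 0
      exact b1
    · show c.x * u 0 < 1
      exact b2
    · funext i
      fin_cases i
      · show c.x⁻¹ * (c.x * u 0) = u 0
        rw [← mul_assoc, ix, one_mul]
      · show (1 - c.x)⁻¹ * (1 - (1 - (1 - c.x) * u 1)) = u 1
        rw [sub_sub_cancel, ← mul_assoc, iy, one_mul]

/-- The chart is `ℚ`-semialgebraic: linear with algebraic coefficients. -/
theorem isSemialgebraicMapOn_cutChart : IsSemialgebraicMapOn ℚ (cutRect c) (cutChart c) := by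
  have hS := isSemialgebraic_cutRect c
  refine IsSemialgebraicMapOn.of_forall hS fun i => ?_
  fin_cases i
  · exact (IsSemialgebraicFunOn.mul_holds (isSemialgebraicFunOn_const_of_isAlgebraic hS c.alg_inv)
      (isSemialgebraicFunOn_aeval hS (X 0))).congr fun t _ => by simp [cutChart]
  · exact (IsSemialgebraicFunOn.mul_holds
      (isSemialgebraicFunOn_const_of_isAlgebraic hS c.symm.alg_inv)
      (isSemialgebraicFunOn_aeval hS (1 - X 1))).congr fun t _ => by simp [cutChart]

/-- The dilogarithm form is the pull-back of `1/(v₀v₁)` under the affine chart. -/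
theorem dilogFun_eq_logSqFun_cutChart (t : Fin 2 → ℝ) :
    dilogFun t = logSqFun (cutChart c t) * (c.x⁻¹ * (1 - c.x)⁻¹) := by
  have hx := c.pos.ne'
  have hy := c.symm_pos.ne'
  simp only [dilogFun, logSqFun, cutChart, Matrix.cons_val_zero, Matrix.cons_val_one]
  by_cases h0 : t 0 = 0
  · simp [h0]
  by_cases h1 : 1 - t 1 = 0
  · simp [h1]
  field_simp

/-- **Affine move.** `P(x) ≡ [(1,1/x) × (1,1/(1−x)), dv/(v₀v₁)]`. -/
theorem rectCut_equiv_logBox :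
    Equivalent (rectCut c) (logBox c.alg_inv c.symm.alg_inv) :=
  equivalent_of_chart (isSemialgebraicMapOn_cutChart c) (fun t _ => hasFDerivAt_cutChart c t)
    (injective_cutChart c).injOn (image_cutChart c) (fun _ _ => abs_det_cutChartDeriv c)
    (fun t _ => dilogFun_eq_logSqFun_cutChart c t) rfl (fun _ _ => rfl) rfl (fun _ _ => rfl)

/-! ## Euler's reflection as an identity of KZ classes -/

/-- **Euler's reflection inside the rules**, raw form:
`[Λ₂] − [D(x)] − [D(1−x)] − [log-box]` is a relation (three moves). -/
theorem simplexTwo_sub_cut : of simplexTwo - of (dilogCut c) - of (dilogCut c.symm) -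
    of (logBox c.alg_inv c.symm.alg_inv) ∈ relations := by
  have e : of simplexTwo - of (dilogCut c) - of (dilogCut c.symm) -
      of (logBox c.alg_inv c.symm.alg_inv) =
      (of simplexTwo - of (dilogCut c) - of (upperCut c) - of (rectCut c)) -
        (of (dilogCut c.symm) - of (upperCut c)) +
        (of (rectCut c) - of (logBox c.alg_inv c.symm.alg_inv)) := by abel
  rw [e]
  exact add_mem (sub_mem (simplexTwo_dissect_cut c) (dilogCut_symm_equiv_upperCut c))
    (rectCut_equiv_logBox c)

/-- **Euler's reflection in `Q`.** `[Λ₂] = [D(x)] + [D(1−x)] + ℓ(1/x)·ℓ(1/(1−x))`. -/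
theorem mkQ_simplexTwo_cut : mkQ (of simplexTwo) =
    mkQ (of (dilogCut c)) + mkQ (of (dilogCut c.symm)) + ell c.x⁻¹ * ell (1 - c.x)⁻¹ := by
  have e : mkQ (of (logBox c.alg_inv c.symm.alg_inv)) = ell c.x⁻¹ * ell (1 - c.x)⁻¹ :=
    mkQ_logBox _ _
  rw [← e, ← map_add, ← map_add, mkQ_eq_mkQ_iff]
  simpa [sub_sub, add_assoc] using simplexTwo_sub_cut c

/-- **Euler's reflection formula for the periods.**
`Li₂(x) + Li₂(1−x) = π²/6 − log(1/x)·log(1/(1−x))`, read off the moves. -/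
theorem dilogCut_value_add_symm : (dilogCut c).value + (dilogCut c.symm).value =
    Real.pi ^ 2 / 6 - Real.log c.x⁻¹ * Real.log (1 - c.x)⁻¹ := by
  have h := congrArg evalQ (mkQ_simplexTwo_cut c)
  have e1 : evalQ (ell c.x⁻¹) = Real.log c.x⁻¹ := evalQ_ell c.alg_inv c.one_lt_inv.le
  have e2 : evalQ (ell (1 - c.x)⁻¹) = Real.log (1 - c.x)⁻¹ :=
    evalQ_ell c.symm.alg_inv c.symm.one_lt_inv.le
  rw [map_add, map_add, map_mul, evalQ_mkQ, evalQ_mkQ, evalQ_mkQ, eval_of, eval_of, eval_of,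
    simplexTwo_value, e1, e2] at h
  linarith

end SoloBlind

end Summit.KontsevichZagierPeriods.KontsevichZagierPeriods.Theorems
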